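import Literature.NumberTheory.Automorphic.Sweep1SymmetricPower
import Literature.NumberTheory.Automorphic.UnramifiedHeckeScalarsFlathProofs
import HarnessLib

/-!
# Symmetric power functoriality (lang.S24): the reduction with the Flath-level inputs proved
(companion to `Literature.NumberTheory.Automorphic.Sweep1SymmetricPower` and
`Literature.NumberTheory.Automorphic.UnramifiedHeckeScalarsFlathProofs`)

`Automorphic/Sweep1SymmetricPower` reduces the named fact
`Literature.NumberTheory.Automorphic.exists_cuspidal_symmetricPower` (**lang.S24**; Newton–Thorne, *Symmetric power
functoriality for holomorphic modular forms, II*, Publ. Math. IHÉS 134 (2021), Thm. A) to the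
newform dictionary `Gelbart1975_exists_isAutomorphicRepOf` (Gelbart 1975, Thm. 5.19), the
weak-lift form of Newton–Thorne's theorem `NewtonThorne2021_exists_cuspidal_symmPowerLift`, and
the Flath-level input "a cuspidal automorphic representation of `GL_n(𝔸_K)` has Satake
parameters with respect to one level `K(𝔑)`, `𝔑 ≠ 0`, at all but finitely many places"
(`Literature.NumberTheory.Automorphic.exists_hasSatakeParameterAt_cofinite`), threaded there as a hypothesis `hS`;
several lemmas of that file also carry "the unramified Hecke operators act by scalars on
`Π^{K(𝔫)}`" (`Literature.NumberTheory.Automorphic.Flath1979_heckeOperatorAt_ofLocal_eq_smul`) as hypotheses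
`hF₂`, `hF`.  Both inputs are now **theorems** of the tree
(`Literature.NumberTheory.Automorphic.exists_hasSatakeParameterAt_cofinite_holds`,
`Literature.NumberTheory.Automorphic.Flath1979_heckeOperatorAt_ofLocal_eq_smul_holds` of
`UnramifiedHeckeScalarsFlathProofs`, Gelfand pair + Schur).  This file records the resulting
hypothesis-free statements, all **proved**:

* `isWeakSymmPowerLift_of_eventually_exists'`, `isWeakSymmPowerLift_iff_eventually_exists'`:
  for cuspidal `π` on `GL₂(𝔸_K)` and `Π` on `GL_{m+1}(𝔸_K)`, `Π` is a weak `Symᵐ`-lift of `π`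
  (`IsWeakSymmPowerLift`, the relation at all pairs of levels) iff `t_{Π,v} = Symᵐ t_{π,v}` for
  all but finitely many `v` at ONE pair of non-zero levels (Newton–Thorne II, §1, p. 117, read
  at the unramified places);
* `isWeakSymmPowerLift_one_self'`, `exists_cuspidal_symmPowerLift_one'`: `Sym¹ π = π`, the case
  `n = 1` of Thm. A, outright;
* `IsWeakSymmPowerLift.unique'`, `existsUnique_cuspidal_symmPowerLift'`: uniqueness of the
  cuspidal weak `Symᵐ`-lift granted strong multiplicity one `strong_multiplicity_one_gl` alone;
* `exists_cuspidal_symmetricPower_of_symmPowerLift'` (**the assembly**):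
  `Gelbart1975_exists_isAutomorphicRepOf → NewtonThorne2021_exists_cuspidal_symmPowerLift →
  exists_cuspidal_symmetricPower`;
* `newtonThorne2021_of_exists_cuspidal_symmetricPower` (**the converse**):
  `exists_cuspidal_symmetricPower → NewtonThorne2021_exists_cuspidal_symmPowerLift`, by Vieta
  (`pair_eq_pair_of_add_eq_of_mul_eq`: the unitary Satake pair of `f` at `p` is determined by
  `a_p(f) p^{-(k-1)/2}` and `χ_f(p)`) and the one-pair-of-levels criterion; hence
  `exists_cuspidal_symmetricPower_iff_newtonThorne2021`: **granted the newform dictionary,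
  lang.S24 as transcribed in `Sweep1` is equivalent to the weak-lift form of Newton–Thorne's
  Thm. A** — the vendored fact is neither weaker nor stronger than what lang.S24 needs.

So `Literature.NumberTheory.Automorphic.exists_cuspidal_symmetricPower` now rests on exactly two named facts:
`Gelbart1975_exists_isAutomorphicRepOf` (classical; no adelisation of newforms on the tree) and
`NewtonThorne2021_exists_cuspidal_symmPowerLift` (Thm. A of the source; far beyond the tree).

## References

* J. Newton, J. A. Thorne, *Symmetric power functoriality for holomorphic modular forms, II*,
  Publ. Math. IHÉS 134 (2021), 117–152: §1 (p. 117), Thm. A (= Thm. 3.1)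
  [NewtonThorneIHES2021b].
* S. Gelbart, *Automorphic forms on adele groups*, Ann. of Math. Stud. 83 (1975), §5:
  Lemma 5.16 with (5.17)–(5.18), Thm. 5.19 [Gelbart1975].
* D. Flath, *Decomposition of representations into tensor products*, Corvallis (1979), Thm. 3
  [FlathCorvallis1979].
-/

noncomputable section

open scoped MatrixGroups
open NumberField IsDedekindDomain MeasureTheory Filter

namespace Literature.NumberTheory.Automorphic

open EllipticCurves.ModularForms

/-! ### Vieta for a pair -/

section Vieta

/-- **A pair is determined by its sum and product** (Vieta in degree `2`, over a domain): if
`a + b = c + d` and `ab = cd` then `{a, b} = {c, d}` as multisets — `(c - a)(c - b) =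
c² - (a + b)c + ab = c² - (c + d)c + cd = 0`. Used to identify the unitary Satake pair
`{α, β}` of a newform `f` at `p` from `α + β = a_p(f) p^{-(k-1)/2}`, `αβ = χ_f(p)` (the data
displayed in `exists_cuspidal_symmetricPower` and `IsAutomorphicRepOf`). [folklore] -/
theorem pair_eq_pair_of_add_eq_of_mul_eq {R : Type*} [CommRing R] [IsDomain R] {a b c d : R}
    (hs : a + b = c + d) (hp : a * b = c * d) : ({a, b} : Multiset R) = {c, d} := by
  have h0 : (c - a) * (c - b) = 0 := by
    have e : (c - a) * (c - b) = c * c - (a + b) * c + a * b := by ring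
    rw [e, hs, hp]
    ring
  rcases mul_eq_zero.mp h0 with h | h
  · obtain rfl : c = a := sub_eq_zero.mp h
    obtain rfl : b = d := add_left_cancel hs
    rfl
  · obtain rfl : c = b := sub_eq_zero.mp h
    have had : a = d := by
      rw [add_comm a c] at hs
      exact add_left_cancel hs
    subst had
    exact Multiset.pair_comm a c

end Vieta

/-! ### Weak symmetric power lifts of cuspidal representations, Flath-level inputs fed -/

section Lift

variable {m : ℕ} {K : Type} [Field K] [NumberField K]

section Cuspidal

variable {μ : Measure (AdelicGroupData.gl 2 K).automorphicQuotient}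
  [(AdelicGroupData.gl 2 K).IsAutomorphicMeasure μ]
  {ν : Measure (AdelicGroupData.gl (m + 1) K).automorphicQuotient}
  [(AdelicGroupData.gl (m + 1) K).IsAutomorphicMeasure ν]

/-- **One pair of levels suffices for cuspidal representations** (hypothesis-free form of
`isWeakSymmPowerLift_of_eventually_exists`, the scalar action of the unramified Hecke operators
being `Flath1979_heckeOperatorAt_ofLocal_eq_smul_holds`). Let `π` on `GL₂(𝔸_K)` and `Π` on
`GL_{m+1}(𝔸_K)` be cuspidal. If for ONE pair of non-zero levels `𝔫₀`, `𝔑₀` and all but finitely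
many `v` there are a Satake pair `{a, b}` of `π` at `v` (level `K(𝔫₀)`) and the Satake parameter
`Symᵐ{a, b}` of `Π` at `v` (level `K(𝔑₀)`), then `Π` is a weak `Symᵐ`-lift of `π`
(`IsWeakSymmPowerLift`, the relation at ALL pairs of levels) — Newton–Thorne II, §1, p. 117, at
the unramified places. [cite: NewtonThorneIHES2021b, §1 (p. 117)] -/
theorem isWeakSymmPowerLift_of_eventually_exists'
    (P : CuspidalAutomorphicRepGL 2 K μ) (Q : CuspidalAutomorphicRepGL (m + 1) K ν)
    {𝔫₀ : Ideal (𝓞 K)} (h𝔫₀ : 𝔫₀ ≠ 0) {𝔑₀ : Ideal (𝓞 K)} (h𝔑₀ : 𝔑₀ ≠ 0)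
    (h : ∀ᶠ v : HeightOneSpectrum (𝓞 K) in cofinite,
      ∃ (ϖ ϖ' : (v.adicCompletion K)ˣ) (a b : ℂ),
        HasSatakeParameterAt P.1 (principalCongruenceLevel 2 K 𝔫₀) v ϖ {a, b} ∧
          HasSatakeParameterAt Q.1 (principalCongruenceLevel (m + 1) K 𝔑₀) v ϖ'
            (symmPowerParams m a b)) :
    IsWeakSymmPowerLift m P.1 Q.1 :=
  isWeakSymmPowerLift_of_eventually_exists Flath1979_heckeOperatorAt_ofLocal_eq_smul_holds
    Flath1979_heckeOperatorAt_ofLocal_eq_smul_holds P Q h𝔫₀ h𝔑₀ h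

/-- **`IsWeakSymmPowerLift` is the characterisation of Newton–Thorne II, §1, at the unramified
places, for cuspidal representations** (hypothesis-free form of
`isWeakSymmPowerLift_iff_eventually_exists`): for cuspidal `π`, `Π` having Satake parameters at
the non-zero levels `K(𝔫₀)`, `K(𝔑₀)` at all but finitely many places (as provided by
`exists_hasSatakeParameterAt_cofinite_holds`), `Π` is a weak `Symᵐ`-lift of `π` iff
`t_{Π,v} = Symᵐ t_{π,v}` for all but finitely many `v`, read at these levels.
[cite: NewtonThorneIHES2021b, §1 (p. 117)] -/
theorem isWeakSymmPowerLift_iff_eventually_exists'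
    (P : CuspidalAutomorphicRepGL 2 K μ) (Q : CuspidalAutomorphicRepGL (m + 1) K ν)
    {𝔫₀ : Ideal (𝓞 K)} (h𝔫₀ : 𝔫₀ ≠ 0) {𝔑₀ : Ideal (𝓞 K)} (h𝔑₀ : 𝔑₀ ≠ 0)
    (hP : ∀ᶠ v : HeightOneSpectrum (𝓞 K) in cofinite,
      ∃ (ϖ : (v.adicCompletion K)ˣ) (α : Multiset ℂ),
        HasSatakeParameterAt P.1 (principalCongruenceLevel 2 K 𝔫₀) v ϖ α)
    (hQ : ∀ᶠ v : HeightOneSpectrum (𝓞 K) in cofinite,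
      ∃ (ϖ' : (v.adicCompletion K)ˣ) (β : Multiset ℂ),
        HasSatakeParameterAt Q.1 (principalCongruenceLevel (m + 1) K 𝔑₀) v ϖ' β) :
    IsWeakSymmPowerLift m P.1 Q.1 ↔
      ∀ᶠ v : HeightOneSpectrum (𝓞 K) in cofinite,
        ∃ (ϖ ϖ' : (v.adicCompletion K)ˣ) (a b : ℂ),
          HasSatakeParameterAt P.1 (principalCongruenceLevel 2 K 𝔫₀) v ϖ {a, b} ∧
            HasSatakeParameterAt Q.1 (principalCongruenceLevel (m + 1) K 𝔑₀) v ϖ'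
              (symmPowerParams m a b) :=
  isWeakSymmPowerLift_iff_eventually_exists Flath1979_heckeOperatorAt_ofLocal_eq_smul_holds
    Flath1979_heckeOperatorAt_ofLocal_eq_smul_holds P Q h𝔫₀ h𝔑₀ hP hQ

/-- **Every cuspidal `Π` on `GL_{m+1}(𝔸_K)` is a weak `Symᵐ`-lift of `π` iff the relation holds
at almost all places for the levels provided by Flath**: combining
`isWeakSymmPowerLift_iff_eventually_exists'` with `exists_hasSatakeParameterAt_cofinite_holds`
for `π` and `Π`, there are non-zero levels `𝔫₀`, `𝔑₀` at which the criterion reads.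
[cite: NewtonThorneIHES2021b, §1 (p. 117)] [cite: FlathCorvallis1979, Thm. 3] -/
theorem exists_levels_isWeakSymmPowerLift_iff
    (P : CuspidalAutomorphicRepGL 2 K μ) (Q : CuspidalAutomorphicRepGL (m + 1) K ν) :
    ∃ (𝔫₀ 𝔑₀ : Ideal (𝓞 K)), 𝔫₀ ≠ 0 ∧ 𝔑₀ ≠ 0 ∧
      (IsWeakSymmPowerLift m P.1 Q.1 ↔
        ∀ᶠ v : HeightOneSpectrum (𝓞 K) in cofinite,
          ∃ (ϖ ϖ' : (v.adicCompletion K)ˣ) (a b : ℂ),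
            HasSatakeParameterAt P.1 (principalCongruenceLevel 2 K 𝔫₀) v ϖ {a, b} ∧
              HasSatakeParameterAt Q.1 (principalCongruenceLevel (m + 1) K 𝔑₀) v ϖ'
                (symmPowerParams m a b)) := by
  obtain ⟨𝔫₀, h𝔫₀, hP⟩ := exists_hasSatakeParameterAt_cofinite_holds P
  obtain ⟨𝔑₀, h𝔑₀, hQ⟩ := exists_hasSatakeParameterAt_cofinite_holds Q
  exact ⟨𝔫₀, 𝔑₀, h𝔫₀, h𝔑₀, isWeakSymmPowerLift_iff_eventually_exists' P Q h𝔫₀ h𝔑₀ hP hQ⟩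

end Cuspidal

section Self

variable {μ : Measure (AdelicGroupData.gl 2 K).automorphicQuotient}
  [(AdelicGroupData.gl 2 K).IsAutomorphicMeasure μ]

/-- **`Sym¹ π = π`**, outright: a cuspidal automorphic representation `π` of `GL₂(𝔸_K)` is its
own weak first symmetric power lift (`isWeakSymmPowerLift_one_self` fed with
`Flath1979_heckeOperatorAt_ofLocal_eq_smul_holds`; the case `n = 1` of Newton–Thorne's Thm. A,
trivially true). [cite: NewtonThorneIHES2021b, Thm. A (n = 1)] -/
theorem isWeakSymmPowerLift_one_self' (P : CuspidalAutomorphicRepGL 2 K μ) :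
    IsWeakSymmPowerLift 1 P.1 P.1 :=
  isWeakSymmPowerLift_one_self Flath1979_heckeOperatorAt_ofLocal_eq_smul_holds P

end Self

section Unique

variable {μ : Measure (AdelicGroupData.gl 2 K).automorphicQuotient}
  [SMulInvariantMeasure (AdelicGroupData.gl 2 K).Adelic
    (AdelicGroupData.gl 2 K).automorphicQuotient μ]
  {ν : Measure (AdelicGroupData.gl (m + 1) K).automorphicQuotient}
  [(AdelicGroupData.gl (m + 1) K).IsAutomorphicMeasure ν]

/-- **Uniqueness of the cuspidal weak `Symᵐ`-lift**, granted strong multiplicity one alone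
(`IsWeakSymmPowerLift.unique` fed with `exists_hasSatakeParameterAt_cofinite_holds`): two
cuspidal `Π, Π'` on `GL_{m+1}(𝔸_K)` (in the same `L²_cusp`) which are weak `Symᵐ`-lifts of the
same `π` (having Satake parameters at some level almost everywhere) coincide, on
`strong_multiplicity_one_gl` for `GL_{m+1}` over `K` (Jacquet–Shalika; a named fact).
[cite: NewtonThorneIHES2021b, §1 (p. 117)] -/
theorem IsWeakSymmPowerLift.unique'
    (hSMO : strong_multiplicity_one_gl (n := m + 1) (K := K) (μ := ν))
    {W : ContRepresentation.ClosedSubrep ((AdelicGroupData.gl 2 K).rightRegular μ)}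
    {𝔫 : Ideal (𝓞 K)}
    (hW : ∀ᶠ v : HeightOneSpectrum (𝓞 K) in cofinite,
      ∃ (ϖ : (v.adicCompletion K)ˣ) (α : Multiset ℂ),
        HasSatakeParameterAt W (principalCongruenceLevel 2 K 𝔫) v ϖ α)
    {Q Q' : CuspidalAutomorphicRepGL (m + 1) K ν}
    (hQ : IsWeakSymmPowerLift m W Q.1) (hQ' : IsWeakSymmPowerLift m W Q'.1) : Q = Q' :=
  hQ.unique hSMO exists_hasSatakeParameterAt_cofinite_holds hW hQ'

end Unique

end Lift

/-! ### lang.S24 over `ℚ`: the assembly on two named facts, and its converse -/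

section Newform

variable {N : ℕ} [NeZero N] {k : ℤ}

/-- **Assembly of lang.S24 from its two remaining named facts.** The newform dictionary
(`Gelbart1975_exists_isAutomorphicRepOf`, Gelbart 1975, Thm. 5.19) and Newton–Thorne's Thm. A
in weak-lift form (`NewtonThorne2021_exists_cuspidal_symmPowerLift`) imply
`exists_cuspidal_symmetricPower` — `exists_cuspidal_symmetricPower_of_symmPowerLift` with its
third input, Satake parameters of cuspidal representations of `GL_{m+1}(𝔸_ℚ)` at one level
almost everywhere, supplied by `exists_hasSatakeParameterAt_cofinite_holds`.
[cite: NewtonThorneIHES2021b, Thm. A] [cite: Gelbart1975, Thm. 5.19] -/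
theorem exists_cuspidal_symmetricPower_of_symmPowerLift'
    (hG : Gelbart1975_exists_isAutomorphicRepOf (N := N) (k := k))
    (hNT : NewtonThorne2021_exists_cuspidal_symmPowerLift (N := N) (k := k)) :
    exists_cuspidal_symmetricPower (N := N) (k := k) :=
  exists_cuspidal_symmetricPower_of_symmPowerLift hG hNT
    fun _ _ _ => exists_hasSatakeParameterAt_cofinite_holds

/-- **lang.S24 implies the weak-lift form of Newton–Thorne's Thm. A** (the converse of the
assembly, unconditionally). Let `f` be a non-CM newform of weight `k ≥ 2`, `P` a cuspidal
automorphic representation of `GL₂(𝔸_ℚ)` which is the automorphic representation of `f`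
(`IsAutomorphicRepOf f P`, at a level `𝔫 ≠ 0`) and `m ≥ 1`. By `exists_cuspidal_symmetricPower`
there is a cuspidal `Q` on `GL_{m+1}(𝔸_ℚ)` with, at a level `𝔑 ≠ 0` and almost all `p`, the
Satake parameter `Symᵐ{α, β}` for SOME pair with `α + β = a_p p^{-(k-1)/2}`, `αβ = χ_f(p)`;
the Satake pair `{α', β'}` of `P` at `p` has the same sum and product, so `{α', β'} = {α, β}`
(Vieta, `pair_eq_pair_of_add_eq_of_mul_eq`), and the one-pair-of-levels criterion
`isWeakSymmPowerLift_of_eventually_exists'` (cuspidality of `P`, `Q` and the Flath-level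
theorems) makes `Q` a weak `Symᵐ`-lift of `P`. [cite: NewtonThorneIHES2021b, Thm. A and §1 (p. 117)] -/
theorem newtonThorne2021_of_exists_cuspidal_symmetricPower
    (h : exists_cuspidal_symmetricPower (N := N) (k := k)) :
    NewtonThorne2021_exists_cuspidal_symmPowerLift (N := N) (k := k) := by
  intro hk f hf hCM μ _ P hP m hm
  obtain ⟨ν, hν, Q, 𝔑, h𝔑, hQ⟩ := h hk hf hCM hm
  obtain ⟨𝔫, h𝔫, hPv⟩ := hP
  refine ⟨ν, hν, Q, isWeakSymmPowerLift_of_eventually_exists' P Q h𝔫 h𝔑 ?_⟩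
  filter_upwards [hPv, hQ] with v hv₁ hv₂
  obtain ⟨-, α', β', hs', hp', ϖ, hα'⟩ := hv₁
  obtain ⟨-, α, β, hs, hp, ϖ', hγ⟩ := hv₂
  have e : ({α', β'} : Multiset ℂ) = {α, β} :=
    pair_eq_pair_of_add_eq_of_mul_eq (hs'.trans hs.symm) (hp'.trans hp.symm)
  refine ⟨ϖ, ϖ', α, β, e ▸ hα', ?_⟩
  rw [symmPowerParams_def]
  exact hγ

/-- **Granted the newform dictionary, lang.S24 is equivalent to the weak-lift form of
Newton–Thorne's Thm. A**: under `Gelbart1975_exists_isAutomorphicRepOf`,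
`exists_cuspidal_symmetricPower ↔ NewtonThorne2021_exists_cuspidal_symmPowerLift`
(`newtonThorne2021_of_exists_cuspidal_symmetricPower`,
`exists_cuspidal_symmetricPower_of_symmPowerLift'`). The vendored named fact is thus exactly as
strong as lang.S24 requires. [cite: NewtonThorneIHES2021b, Thm. A and §1 (p. 117)] -/
theorem exists_cuspidal_symmetricPower_iff_newtonThorne2021
    (hG : Gelbart1975_exists_isAutomorphicRepOf (N := N) (k := k)) :
    exists_cuspidal_symmetricPower (N := N) (k := k) ↔
      NewtonThorne2021_exists_cuspidal_symmPowerLift (N := N) (k := k) :=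
  ⟨newtonThorne2021_of_exists_cuspidal_symmetricPower,
    exists_cuspidal_symmetricPower_of_symmPowerLift' hG⟩

/-- **The case `m = 1` of the Newton–Thorne fact holds outright: `Sym¹ P = P`** for every
cuspidal `P` on `GL₂(𝔸_ℚ)` (`exists_cuspidal_symmPowerLift_one` fed with
`Flath1979_heckeOperatorAt_ofLocal_eq_smul_holds`; Newton–Thorne II, Thm. A with `n = 1`,
trivially true). [cite: NewtonThorneIHES2021b, Thm. A (n = 1)] -/
theorem exists_cuspidal_symmPowerLift_one'
    (μ : Measure (AdelicGroupData.gl 2 ℚ).automorphicQuotient)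
    [(AdelicGroupData.gl 2 ℚ).IsAutomorphicMeasure μ] (P : CuspidalAutomorphicRepGL 2 ℚ μ) :
    ∃ (ν : Measure (AdelicGroupData.gl (1 + 1) ℚ).automorphicQuotient)
      (_ : (AdelicGroupData.gl (1 + 1) ℚ).IsAutomorphicMeasure ν)
      (Q : CuspidalAutomorphicRepGL (1 + 1) ℚ ν), IsWeakSymmPowerLift 1 P.1 Q.1 :=
  exists_cuspidal_symmPowerLift_one (fun _ _ => Flath1979_heckeOperatorAt_ofLocal_eq_smul_holds)
    μ P

/-- **`Symᵐ π_f` is well defined**, granted the Newton–Thorne fact and strong multiplicity one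
for `GL_{m+1}` over `ℚ` only (`existsUnique_cuspidal_symmPowerLift` fed with
`exists_hasSatakeParameterAt_cofinite_holds`): for `f` a non-CM newform of weight `k ≥ 2`, `P`
its cuspidal automorphic representation and `m ≥ 1`, some `L²_cusp(GL_{m+1}(𝔸_ℚ) ⧸ A_G
GL_{m+1}(ℚ))` contains EXACTLY ONE cuspidal weak `Symᵐ`-lift of `P`.
[cite: NewtonThorneIHES2021b, Thm. A and §1 (p. 117)] -/
theorem existsUnique_cuspidal_symmPowerLift'
    (hNT : NewtonThorne2021_exists_cuspidal_symmPowerLift (N := N) (k := k))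
    (hSMO : ∀ (m : ℕ) (ν : Measure (AdelicGroupData.gl (m + 1) ℚ).automorphicQuotient)
      [(AdelicGroupData.gl (m + 1) ℚ).IsAutomorphicMeasure ν],
      strong_multiplicity_one_gl (n := m + 1) (K := ℚ) (μ := ν))
    (hk : 2 ≤ k) {f : CuspForm (CongruenceSubgroup.Gamma1 N) k} (hf : IsNewform1 f)
    (hCM : ¬ IsCMForm f) (μ : Measure (AdelicGroupData.gl 2 ℚ).automorphicQuotient)
    [(AdelicGroupData.gl 2 ℚ).IsAutomorphicMeasure μ] (P : CuspidalAutomorphicRepGL 2 ℚ μ)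
    (hP : IsAutomorphicRepOf f P.1) {m : ℕ} (hm : 1 ≤ m) :
    ∃ (ν : Measure (AdelicGroupData.gl (m + 1) ℚ).automorphicQuotient)
      (_ : (AdelicGroupData.gl (m + 1) ℚ).IsAutomorphicMeasure ν),
      ∃! Q : CuspidalAutomorphicRepGL (m + 1) ℚ ν, IsWeakSymmPowerLift m P.1 Q.1 :=
  existsUnique_cuspidal_symmPowerLift hNT (fun _ _ _ => exists_hasSatakeParameterAt_cofinite_holds)
    hSMO hk hf hCM μ P hP hm

/-- **lang.S24 with uniqueness, on the two named facts and strong multiplicity one.** Granted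
`Gelbart1975_exists_isAutomorphicRepOf`, `NewtonThorne2021_exists_cuspidal_symmPowerLift` and
`strong_multiplicity_one_gl` for `GL_{m+1}` over `ℚ`: for `f` a non-CM newform of weight
`k ≥ 2` and `m ≥ 1` there are a cuspidal `P` on `GL₂(𝔸_ℚ)` which is the automorphic
representation of `f` and an `L²_cusp` of `GL_{m+1}(𝔸_ℚ)` containing exactly one cuspidal weak
`Symᵐ`-lift of `P` (Newton–Thorne II, Thm. A with §1: `Symᵐ π` exists and is characterised by
the local relation). [cite: NewtonThorneIHES2021b, Thm. A and §1 (p. 117)]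
[cite: Gelbart1975, Thm. 5.19] -/
theorem exists_existsUnique_cuspidal_symmPowerLift
    (hG : Gelbart1975_exists_isAutomorphicRepOf (N := N) (k := k))
    (hNT : NewtonThorne2021_exists_cuspidal_symmPowerLift (N := N) (k := k))
    (hSMO : ∀ (m : ℕ) (ν : Measure (AdelicGroupData.gl (m + 1) ℚ).automorphicQuotient)
      [(AdelicGroupData.gl (m + 1) ℚ).IsAutomorphicMeasure ν],
      strong_multiplicity_one_gl (n := m + 1) (K := ℚ) (μ := ν))
    (hk : 2 ≤ k) {f : CuspForm (CongruenceSubgroup.Gamma1 N) k} (hf : IsNewform1 f)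
    (hCM : ¬ IsCMForm f) {m : ℕ} (hm : 1 ≤ m) :
    ∃ (μ : Measure (AdelicGroupData.gl 2 ℚ).automorphicQuotient)
      (_ : (AdelicGroupData.gl 2 ℚ).IsAutomorphicMeasure μ) (P : CuspidalAutomorphicRepGL 2 ℚ μ)
      (_ : IsAutomorphicRepOf f P.1)
      (ν : Measure (AdelicGroupData.gl (m + 1) ℚ).automorphicQuotient)
      (_ : (AdelicGroupData.gl (m + 1) ℚ).IsAutomorphicMeasure ν),
      ∃! Q : CuspidalAutomorphicRepGL (m + 1) ℚ ν, IsWeakSymmPowerLift m P.1 Q.1 := by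
  obtain ⟨μ, hμ, P, hP⟩ := hG hk hf
  obtain ⟨ν, hν, huniq⟩ := existsUnique_cuspidal_symmPowerLift' hNT hSMO hk hf hCM μ P hP hm
  exact ⟨μ, hμ, P, hP, ν, hν, huniq⟩

end Newform

end Literature.NumberTheory.Automorphic
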